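import Summits.Schanuel.Schanuel.Theorems.RootDecomp1BAlgFrame02

/-!
# RootDecomp1BAlgFrame — lens 4, generation 40 «UNBOUNDED-DEGREE FRAMES» (lane B-R24 (b′), PRICE B-β, RULE B-R26): X(2) and the three At-cells at (1 | ρ) for every ρ in the class `AlgUltraLiouville` (doubly-exponential hyper-approximation by real algebraic irrationals of UNBOUNDED degree) modulo `Roy2014_thm_1_1` ONLY — the degree a running parameter of Roy's point-explicit L–W measure (budget lemma `algFrameMeasure_explicit_of_roy` with the floor exp(−royC D·exp(A^8)·(1+log H)) in its TYPE); the NAMED MEMBER ρ_A (a tower over 2^{1/p}, prime degrees p → ∞) with HYPOTHESIS-FREE membership, degree certificate [ℚ(β_K):ℚ] = g_K, position certificate |ρ_A − γ| ≥ exp(−A⁴) and the exclusions BY TREE NAMES (¬Hyper, ¬QuadHyper, ¬Ultra ×2, ¬LiouvilleOrder 8, transcendental) — continuation (RootDecomp1BAlgFrame03): §E the engine mod hRoy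

(lens-4 g40 HOME kernel AlgFrame.lean fe3f4606…, 1974 l, imports tree RootDecomp1BQuadFrame05 + RootDecomp1EPointTransfer04 only; CLAIM L2078, RULING + CHECKLIST B-g40 L2080, NODE L2101 / REQUEST L2102 / RESULT L2103, critic VERDICT L2111 (crit g9: (A) CLEARED — ONE CELL (B-β); lens-4 tally THEOREM ×6 + CELL ×3; RULE B-R26 in force (the Roy-transfer line on 1B CLOSED); PORT GO 01–09 `--supports stmt-Schanuel-24622`); port by census-1 gen 18 as `RootDecomp1BAlgFrame01`–`09` along K's sections: 01 = §D the class `AlgUltraLiouville` + the measure shape `AlgFrameMeasure` + §R helpers (`royC`); 02 = §R the budget lemma `algFrameMeasure_explicit_of_roy` (Roy ⟹ the algebraic frame measure in EVERY degree; scoped `maxHeartbeats 1600000` carried as in K); 03 = §E the engine `algebraicIndependent_exp_frame_of_algUltraLiouville (hRoy)` + the `![…]` forms; 04 = §M.1–§M.3 prime degrees `gdeg`, radicals `theta`, frame data `Nseq`/`Pseq`/`fd` (with `attribute [irreducible] fd`), `betaSeq`, `fSeq`, `ASeq`, growth; 05 = §M.4–§M.5 increments, the limit `rhoA`, MEMBERSHIP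 `algUltraLiouville_rhoA`; 06 = §M.6–§M.7 degree certificate `finrank_adjoin_theta` / `adjoin_betaSeq_eq` + the number-field Liouville inequality (`FK`, `thetaF`, `sigma0`, norm to ℚ); 07 = §M.8–§M.9 the frame bound, the tower inequality, scale selection, `cert_arith`; 08 = §M.10–§M.11 THE POSITION CERTIFICATE `rhoA_far_from_degree_le` + EXCLUSIONS by tree names (`not_hyperLiouville_rhoA`, `not_quadHyperLiouville_rhoA`, `not_ultraLiouville_rhoA` / `'`, `not_liouvilleOrder_rhoA`, `transcendental_rhoA`); 09 = §C the cells `four_le_polarDeg_one_of_algUltra (hRoy)` (+ swap), the At-cells, the member cells at ρ_A, `rhoA_position`.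
PORT EDITS: the three `set_option linter.*` lines dropped and the one surfaced `unnecessarySimpa` fixed (`simpa using h12` ↦ `simp`, §R); 74 one-line docstrings added; two generic helpers made `private` (`three_mul_le_two_pow`, `half_identity`) with per-part private copies of those and of K's own private helpers; statements and proofs verbatim. `--supports stmt-Schanuel-24622`; no census credit carried; rung 0 — nothing here proves Schanuel.)
-/

noncomputable section

open Complex IntermediateField MvPolynomial

namespace Summit.Schanuel.Schanuel.Theorems.RootDecomp1BAlgFrame

open Summit.Schanuel.Schanuel.Theorems.RootDecomp1EPointTransfer (Roy2014_thm_1_1)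
open Summit.Schanuel.Schanuel.Theorems.RootDecomp1KHyper (mvlen mvlen_nonneg abs_coeff_le_mvlen one_le_mvlen)
open Summit.Schanuel.Schanuel.Theorems.RootDecomp1BHyperFrame (royDeg royS RoyNF roy_tree_iff framePt Ff
  Ff_eq_aeval exists_lipschitz_Ff linearIndependent_one_irrational)
open Summit.Schanuel.Schanuel.Theorems.RootDecomp1BQuadFrame (qy qe qpt qpt_apply framePt_qy_qe linearIndependent_qpt
  QuadHyperLiouville)
open Summit.Schanuel.Schanuel.Theorems.RootDecomp1BFedFlagCore (KleinIH polarDeg polarField)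
open Summit.Schanuel.Schanuel.Theorems.RootDecomp1BDefectFloorDefs (SharpRelativeLindemannAt TameDefectZeroAt
  WildSharpDefectZeroAt WildSharpDefectZeroInitAt WildSharpInitAt)
open Summit.Schanuel.Schanuel.Theorems.RootDecomp1BDefectFloorCells (natCast_le_trdeg_of_algebraicIndependent)
open Summit.Schanuel.Schanuel.Theorems.RootDecomp1BRadicalDescent (exists_int_relation)
open Summit.Schanuel.Schanuel.Theorems.RootDecomp1BMovingZero (mem_polarField_one mem_polarField_swap)

/-- `x ≤ exp x`. -/
private theorem le_exp_self (x : ℝ) : x ≤ Real.exp x := by linarith [Real.add_one_le_exp x]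

/-! ## §E  The engine: AlgFrameMeasure + AlgUltraLiouville ⟹ `e, e^ρ, e^i, e^{iρ}` algebraically independent -/

section Engine

/-- `F(x) = P(e, e^x, e^i, e^{ix})` is the frame function `Ff` of the renamed polynomial (no `X₀`). -/
theorem Ff_rename_eq (P : MvPolynomial (Fin 4) ℤ) (x : ℝ) :
    Ff (rename Fin.succ P) qy qe x = aeval (fun j => cexp (qpt x j)) P := by
  rw [Ff_eq_aeval, framePt_qy_qe, aeval_rename]
  rfl

/-- **THE ENGINE.**  `AlgFrameMeasure` and `ρ ∈ AlgUltraLiouville` make `e, e^ρ, e^i, e^{iρ}` algebraically independent. -/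
theorem algebraicIndependent_exp_qpt_of_algFrameMeasure (hF : AlgFrameMeasure) {ρ : ℝ}
    (hρ : AlgUltraLiouville ρ) : AlgebraicIndependent ℚ (fun j => cexp (qpt ρ j)) := by
  classical
  by_contra hdep
  obtain ⟨P, hP0, hPρ⟩ := exists_int_relation hdep
  have hFρ : Ff (rename Fin.succ P) qy qe ρ = 0 := by rw [Ff_rename_eq]; exact hPρ
  obtain ⟨Kl, δ₁, hKl, hδ₁, hlip⟩ := exists_lipschitz_Ff (rename Fin.succ P) qy qe ρ
  -- the degree, the height, the measure in that degree
  obtain ⟨D, hD⟩ : ∃ D : ℕ, D = P.totalDegree := ⟨_, rfl⟩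
  obtain ⟨C, N, hC, hFM⟩ := hF D
  obtain ⟨Hz, hHz⟩ : ∃ Hz : ℤ, Hz = mvlen P := ⟨_, rfl⟩
  have hHz1 : 1 ≤ Hz := by rw [hHz]; exact one_le_mvlen hP0
  obtain ⟨H, hH⟩ : ∃ H : ℕ, H = Hz.toNat := ⟨_, rfl⟩
  have hHZ : (H : ℤ) = Hz := by rw [hH]; exact Int.toNat_of_nonneg (by linarith)
  have hH1 : 1 ≤ H := by
    have h : (1 : ℤ) ≤ (H : ℤ) := by rw [hHZ]; exact hHz1
    exact_mod_cast h
  have hcoef : ∀ s, |P.coeff s| ≤ (H : ℤ) := fun s => by rw [hHZ, hHz]; exact abs_coeff_le_mvlen P s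
  have hH1R : (1 : ℝ) ≤ H := by exact_mod_cast hH1
  have hlogH : 0 ≤ Real.log H := Real.log_nonneg hH1R
  -- the level `m`
  obtain ⟨Γ, hΓ⟩ : ∃ Γ : ℝ, Γ = C * (1 + Real.log H) + Kl + 1 := ⟨_, rfl⟩
  have hΓ0 : 0 ≤ Γ := by rw [hΓ]; positivity
  obtain ⟨m₁, hm₁⟩ : ∃ m₁ : ℕ, Γ + δ₁⁻¹ + 2 < m₁ := exists_nat_gt _
  obtain ⟨m, hm⟩ : ∃ m : ℕ, m = N + 1 + m₁ := ⟨_, rfl⟩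
  -- the approximant at level `m`
  obtain ⟨β, f, A, hmA, hirr, hf0, hfdeg, hfA, hfβ, hlt⟩ := hρ m
  have hδ₁inv : 0 < δ₁⁻¹ := inv_pos.mpr hδ₁
  have hm₁A : (m₁ : ℝ) ≤ A := by exact_mod_cast le_trans (by omega) hmA
  have hA2 : (2 : ℝ) ≤ A := by linarith
  have hA1 : (1 : ℝ) ≤ A := by linarith
  have hmN : N + 1 ≤ m := by omega
  -- smallness of the distance: `exp(−exp(A^m)) ≤ exp(−A) < δ₁`
  have hAexpA : (A : ℝ) ≤ Real.exp ((A : ℝ) ^ m) := by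
    calc (A : ℝ) = (A : ℝ) ^ 1 := (pow_one _).symm
      _ ≤ (A : ℝ) ^ m := pow_le_pow_right₀ hA1 (by omega)
      _ ≤ Real.exp ((A : ℝ) ^ m) := le_exp_self _
  have hsmall : |ρ - β| < Real.exp (-(A : ℝ)) :=
    hlt.trans_le (Real.exp_le_exp.mpr (neg_le_neg hAexpA))
  have hexpA : Real.exp (-(A : ℝ)) < δ₁ := by
    rw [Real.exp_neg, inv_lt_comm₀ (Real.exp_pos _) hδ₁]
    linarith [Real.add_one_le_exp (A : ℝ)]
  have hdist₁ : |β - ρ| < δ₁ := by rw [abs_sub_comm]; exact hsmall.trans hexpA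
  -- THE MEASURE at `β`
  have hlow := hFM β f A hirr hf0 hfdeg hfA hfβ P hP0 (le_of_eq hD.symm) H hH1 hcoef
  -- THE SMALLNESS at `β`
  have hup : ‖aeval (fun j => cexp (qpt β j)) P‖ ≤ (Kl + 1) * Real.exp (-Real.exp ((A : ℝ) ^ m)) := by
    have h1 := hlip β hdist₁
    rw [hFρ, sub_zero, Ff_rename_eq] at h1
    calc ‖aeval (fun j => cexp (qpt β j)) P‖ ≤ Kl * |β - ρ| := h1
      _ ≤ (Kl + 1) * |β - ρ| := mul_le_mul_of_nonneg_right (by linarith) (abs_nonneg _)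
      _ ≤ (Kl + 1) * Real.exp (-Real.exp ((A : ℝ) ^ m)) :=
          mul_le_mul_of_nonneg_left (by rw [abs_sub_comm]; exact hlt.le) (by linarith)
  -- comparison: `x := exp(A^N) ≥ 1`, `exp(A^m) ≥ A·x`, `A > Γ + 2`
  obtain ⟨x, hx⟩ : ∃ x : ℝ, x = Real.exp ((A : ℝ) ^ N) := ⟨_, rfl⟩
  have hx1 : 1 ≤ x := by rw [hx]; exact Real.one_le_exp (by positivity)
  have hAN1 : (1 : ℝ) ≤ (A : ℝ) ^ N := one_le_pow₀ hA1
  have hEm : (A : ℝ) * x ≤ Real.exp ((A : ℝ) ^ m) := by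
    have h1 : (A : ℝ) ^ (N + 1) ≤ (A : ℝ) ^ m := pow_le_pow_right₀ hA1 hmN
    have h2 : ((A : ℝ) - 1) + (A : ℝ) ^ N ≤ (A : ℝ) ^ (N + 1) := by
      rw [pow_succ]
      nlinarith
    have h3 : (A : ℝ) ≤ Real.exp ((A : ℝ) - 1) := by linarith [Real.add_one_le_exp ((A : ℝ) - 1)]
    calc (A : ℝ) * x ≤ Real.exp ((A : ℝ) - 1) * x := mul_le_mul_of_nonneg_right h3 (by linarith)
      _ = Real.exp (((A : ℝ) - 1) + (A : ℝ) ^ N) := by rw [hx, ← Real.exp_add]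
      _ ≤ Real.exp ((A : ℝ) ^ m) := Real.exp_le_exp.mpr (h2.trans h1)
  have hgap : Kl + 3 ≤ Real.exp ((A : ℝ) ^ m) - C * x * (1 + Real.log H) := by
    have h1 : C * (1 + Real.log H) + Kl + 3 ≤ A := by
      have : Γ + 2 < A := by linarith
      rw [hΓ] at this; linarith
    have h2 : x * (C * (1 + Real.log H) + Kl + 3) ≤ x * A := mul_le_mul_of_nonneg_left h1 (by linarith)
    have h3 : Kl + 3 ≤ x * (Kl + 3) := by nlinarith
    nlinarith
  have hfinal : (Kl + 1) * Real.exp (-Real.exp ((A : ℝ) ^ m)) <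
      Real.exp (-(C * Real.exp ((A : ℝ) ^ N) * (1 + Real.log H))) := by
    rw [← hx]
    have h1 : Real.exp (-(C * x * (1 + Real.log H))) =
        Real.exp (Real.exp ((A : ℝ) ^ m) - C * x * (1 + Real.log H)) * Real.exp (-Real.exp ((A : ℝ) ^ m)) := by
      rw [← Real.exp_add]; congr 1; ring
    rw [h1]
    refine mul_lt_mul_of_pos_right ?_ (Real.exp_pos _)
    calc Kl + 1 < Kl + 3 + 1 := by linarith
      _ ≤ Real.exp (Kl + 3) := Real.add_one_le_exp _
      _ ≤ Real.exp (Real.exp ((A : ℝ) ^ m) - C * x * (1 + Real.log H)) := Real.exp_le_exp.mpr hgap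
  exact absurd (hlow.trans hup) (not_le.mpr hfinal)

/-- **CELL ENGINE mod Roy only.** -/
theorem algebraicIndependent_exp_qpt_of_algUltra (hRoy : Roy2014_thm_1_1) {ρ : ℝ}
    (hρ : AlgUltraLiouville ρ) : AlgebraicIndependent ℚ (fun j => cexp (qpt ρ j)) :=
  algebraicIndependent_exp_qpt_of_algFrameMeasure (algFrameMeasure_of_roy hRoy) hρ

/-- **CELL ENGINE, `![…]`-form** (CHECKLIST B-g40 (2); the fourth coordinate is `ρ·i`, equal to the `i·ρ` of the
claim text by `mul_comm`). -/
theorem algebraicIndependent_exp_frame_of_algUltraLiouville (hRoy : Roy2014_thm_1_1) {ρ : ℝ}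
    (hρ : AlgUltraLiouville ρ) : AlgebraicIndependent ℚ ![cexp 1, cexp ρ, cexp I, cexp (ρ * I)] := by
  have h := algebraicIndependent_exp_qpt_of_algUltra hRoy hρ
  have hfun : (fun j => cexp (qpt ρ j)) = ![cexp 1, cexp ρ, cexp I, cexp (ρ * I)] := by
    funext j
    rw [qpt_apply]
    fin_cases j <;> simp
  rwa [hfun] at h

/-- the same with the claim's spelling `i·ρ` of the fourth exponent -/
theorem algebraicIndependent_exp_frame_of_algUltraLiouville' (hRoy : Roy2014_thm_1_1) {ρ : ℝ}
    (hρ : AlgUltraLiouville ρ) : AlgebraicIndependent ℚ ![cexp 1, cexp ρ, cexp I, cexp (I * ρ)] := by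
  rw [mul_comm]; exact algebraicIndependent_exp_frame_of_algUltraLiouville hRoy hρ

end Engine

end Summit.Schanuel.Schanuel.Theorems.RootDecomp1BAlgFrame

end
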